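import Summits.NavierStokesRegularity.NavierStokesRegularity.Theorems.PerpetualPumpEulerTypeIGlueDensity
import Summits.NavierStokesRegularity.NavierStokesRegularity.Theorems.PerpetualPumpEulerTypeIGlueDuhamel

/-!
# Route PerpetualPump · `EulerTypeIGlue` — stub `stub_testToH10` (line `Sketch`)

Tao's mild identity (2016, (1.15)) at viscosity `ν` for the complexified curve `U`,
`⟨U t, w⟩ = ⟨e^{νtΔ} U 0, w⟩ + ∫₀ᵗ ⟨B(U s, U s), e^{ν(t-s)Δ} w⟩ ds`,
known for every complexified divergence-free test field `w = [φ^ℂ]`, `φ ∈ C_{c,σ}^∞`, extends to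
every `w ∈ H¹⁰_df` by an `L²`-closure argument (no `H¹⁰` density is needed):

* `C_{c,σ}^∞` is `L²`-dense in the real Fourier-divergence-free classes
  (`exists_divFreeTest_tendsto`, Temam 1977 Ch. I Thm. 1.4/1.6, landed);
* `z ↦ ⟨a, z⟩` is a continuous linear functional on `L²` (`pairing_eq_inner_conjL2`);
* the Duhamel term is Lipschitz in the `L²` test slot: by trilinearity (`eulerForm_sub₃`),
  linearity and `L²`-contractivity of `e^{τΔ}` (`fourierMultiplier_sub`, `norm_heat_le`) and the
  bound `|⟨B(u,u), z⟩| ≤ K ‖u‖²_{H¹⁰} ‖z‖` (`norm_eulerForm_le`, Tao p. 7), with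
  `sup_{[0,t]} ‖U s‖_{H¹⁰} < ∞` (`ContinuousInH10On.exists_bound`); the integrands are continuous
  in `s` (a version of the landed `continuousOn_eulerForm_heat` with an arbitrary
  `L²`-continuous test curve), hence interval integrable.

## References

* T. Tao, J. Amer. Math. Soc. 29 (2016), arXiv:1402.0290v3, §1.1 (1.15), p. 7. [Tao2016AveragedNS]
* R. Temam, *Navier–Stokes Equations* (1977), Ch. I, Thm. 1.4 / Thm. 1.6. [Temam1977]
-/

noncomputable section

open MeasureTheory Set Filter Topology FourierTransform
open scoped ENNReal NNReal RealInnerProductSpace SchwartzMap ContDiff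

set_option linter.dupNamespace false

namespace Summit.NavierStokesRegularity.NavierStokesRegularity.Theorems.PerpetualPumpEulerTypeIGlue

open Literature.Analysis.FluidPDE Literature.Analysis.FluidPDE.Tao2016
open Literature.Analysis.FunctionSpaces (eFourierSobolevNorm)
open Literature.Analysis.FunctionSpaces.EuclideanSpace (complexify complexify_apply norm_complexify
  continuous_complexify)

/-- Local notation for physical / frequency space `ℝ³`. -/
local notation "ℝ³" => EuclideanSpace ℝ (Fin 3)

/-! ### Continuity in the `L²` test slot -/

/-- `z ↦ ⟨a, z⟩` is continuous on `L²` (it is the inner product against `ā`). [folklore] -/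
theorem continuous_pairing_right (a : L2C) : Continuous fun z : L2C => pairing a z := by
  have h : (fun z : L2C => pairing a z) = fun z => inner ℂ (conjL2 a) z := by
    funext z
    rw [pairing_swap, pairing_eq_inner_conjL2]
  rw [h]
  exact continuous_const.inner continuous_id

/-- **The integrand `s ↦ ⟨B(v(s), v(s)), Z(s)⟩` is continuous** on a time set on which `v` is
`H¹⁰`-continuous with finite, bounded `H¹⁰` norms and `Z` is `L²`-continuous (Tao 2016, p. 7: the
form converges absolutely on `H¹⁰ × H¹⁰ × L²`; trilinearity). [cite: Tao2016AveragedNS, §1.1 (1.15) p. 7] -/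
theorem continuousOn_eulerForm_of_continuousOn {I : Set ℝ} {v : ℝ → L2C}
    (hv : ContinuousInH10On I v) (hfin : ∀ s ∈ I, eFourierSobolevNorm 10 (v s) < ⊤) {M : ℝ}
    (hM : ∀ s ∈ I, (eFourierSobolevNorm 10 (v s)).toReal ≤ M) {Z : ℝ → L2C}
    (hZ : ContinuousOn Z I) :
    ContinuousOn (fun s => eulerForm (v s) (v s) (Z s)) I := by
  set K : ℝ := Real.pi * (2 * ((∫⁻ ξ : ℝ³, ENNReal.ofReal ((1 + ‖ξ‖ ^ 2) ^ (-10 : ℝ))) ^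
      (1 / 2 : ℝ)).toReal) with hK
  have hK0 : 0 ≤ K := by positivity
  set M' : ℝ := max M 0 with hM'
  have hreal : ∀ s ∈ I, (eFourierSobolevNorm 10 (v s)).toReal ≤ M' := fun s hs =>
    (hM s hs).trans (le_max_left _ _)
  intro s₀ hs₀
  rw [ContinuousWithinAt, tendsto_iff_norm_sub_tendsto_zero]
  -- the three-term decomposition and its bound
  have hbound : ∀ s ∈ I, ‖eulerForm (v s) (v s) (Z s) - eulerForm (v s₀) (v s₀) (Z s₀)‖ ≤
      K * (eFourierSobolevNorm 10 (v s - v s₀)).toReal * M' * ‖Z s‖ +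
      K * M' * (eFourierSobolevNorm 10 (v s - v s₀)).toReal * ‖Z s‖ +
      K * M' * M' * ‖Z s - Z s₀‖ := by
    intro s hs
    have e1 := eulerForm_sub₁ (Z s) (hfin s hs) (hfin s₀ hs₀) (hfin s hs)
    have e2 := eulerForm_sub₂ (Z s) (hfin s₀ hs₀) (hfin s hs) (hfin s₀ hs₀)
    have e3 := eulerForm_sub₃ (Z s) (Z s₀) (hfin s₀ hs₀) (hfin s₀ hs₀)
    have hdec : eulerForm (v s) (v s) (Z s) - eulerForm (v s₀) (v s₀) (Z s₀) =
        eulerForm (v s - v s₀) (v s) (Z s) + eulerForm (v s₀) (v s - v s₀) (Z s) +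
          eulerForm (v s₀) (v s₀) (Z s - Z s₀) := by
      rw [← e1, ← e2, ← e3]; ring
    rw [hdec]
    have hsub := eFourierSobolevNorm_sub_lt_top (hfin s hs) (hfin s₀ hs₀)
    refine (norm_add₃_le).trans (add_le_add_three ?_ ?_ ?_)
    · refine (norm_eulerForm_le _ hsub (hfin s hs)).trans ?_
      have h1 := hreal s hs
      gcongr
    · refine (norm_eulerForm_le _ (hfin s₀ hs₀) hsub).trans ?_
      have h1 := hreal s₀ hs₀
      gcongr
    · refine (norm_eulerForm_le _ (hfin s₀ hs₀) (hfin s₀ hs₀)).trans ?_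
      have h1 := hreal s₀ hs₀
      gcongr
  -- the vanishing quantities
  have hH10 : Tendsto (fun s => (eFourierSobolevNorm 10 (v s - v s₀)).toReal) (𝓝[I] s₀) (𝓝 0) := by
    have h := (ENNReal.tendsto_toReal ENNReal.zero_ne_top).comp (hv s₀ hs₀)
    rw [ENNReal.toReal_zero] at h
    exact h
  have hZ0 : Tendsto (fun s => ‖Z s - Z s₀‖) (𝓝[I] s₀) (𝓝 0) := by
    have h := ((hZ s₀ hs₀).sub_const (Z s₀)).norm
    simp only [sub_self, norm_zero] at h
    exact h
  have hZn : Tendsto (fun s => ‖Z s‖) (𝓝[I] s₀) (𝓝 ‖Z s₀‖) := (hZ s₀ hs₀).norm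
  have hrhs : Tendsto (fun s => K * (eFourierSobolevNorm 10 (v s - v s₀)).toReal * M' * ‖Z s‖ +
      K * M' * (eFourierSobolevNorm 10 (v s - v s₀)).toReal * ‖Z s‖ +
      K * M' * M' * ‖Z s - Z s₀‖) (𝓝[I] s₀) (𝓝 0) := by
    have h1 : Tendsto (fun s => K * (eFourierSobolevNorm 10 (v s - v s₀)).toReal * M' * ‖Z s‖)
        (𝓝[I] s₀) (𝓝 (K * 0 * M' * ‖Z s₀‖)) := ((hH10.const_mul K).mul_const M').mul hZn
    have h2 : Tendsto (fun s => K * M' * (eFourierSobolevNorm 10 (v s - v s₀)).toReal * ‖Z s‖)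
        (𝓝[I] s₀) (𝓝 (K * M' * 0 * ‖Z s₀‖)) := (hH10.const_mul (K * M')).mul hZn
    have h3 : Tendsto (fun s => K * M' * M' * ‖Z s - Z s₀‖) (𝓝[I] s₀) (𝓝 (K * M' * M' * 0)) :=
      hZ0.const_mul (K * M' * M')
    simpa using (h1.add h2).add h3
  refine squeeze_zero_norm' ?_ hrhs
  filter_upwards [self_mem_nhdsWithin] with s hs
  rw [norm_norm]
  exact hbound s hs

/-! ### The Duhamel term is continuous in the `L²` test slot -/

/-- **`L²`-continuity of the Duhamel term in the test slot**: if `Φ n → w` in `L²`, then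
`∫₀ᵗ ⟨B(U s, U s), e^{ν(t-s)Δ} Φ n⟩ ds → ∫₀ᵗ ⟨B(U s, U s), e^{ν(t-s)Δ} w⟩ ds`, for an
`H¹⁰`-continuous curve `U` with finite `H¹⁰` norms on `[0,t]`
(`|∫₀ᵗ ⟨B(U,U), e^{ν(t-s)Δ}(Φ n - w)⟩| ≤ t K sup‖U‖²_{H¹⁰} ‖Φ n - w‖`). [cite: Tao2016AveragedNS, §1.1 (1.15) p. 7] -/
theorem tendsto_intervalIntegral_eulerForm_heat {ν t : ℝ} (ht : 0 ≤ t) {U : ℝ → L2C}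
    (hfin : ∀ s ∈ Icc 0 t, eFourierSobolevNorm 10 (U s) < ⊤) (hc : ContinuousInH10On (Icc 0 t) U)
    {Φ : ℕ → L2C} {w : L2C} (hΦ : Tendsto Φ atTop (𝓝 w)) :
    Tendsto (fun n => ∫ s in (0:ℝ)..t, eulerForm (U s) (U s) (heat (ν * (t - s)) (Φ n))) atTop
      (𝓝 (∫ s in (0:ℝ)..t, eulerForm (U s) (U s) (heat (ν * (t - s)) w))) := by
  obtain ⟨M, hM⟩ := hc.exists_bound hfin
  set K : ℝ := Real.pi * (2 * ((∫⁻ ξ : ℝ³, ENNReal.ofReal ((1 + ‖ξ‖ ^ 2) ^ (-10 : ℝ))) ^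
      (1 / 2 : ℝ)).toReal) with hK
  have hK0 : 0 ≤ K := by positivity
  set M' : ℝ := max M 0 with hM'
  have hreal : ∀ s ∈ Icc 0 t, (eFourierSobolevNorm 10 (U s)).toReal ≤ M' := fun s hs =>
    (hM s hs).trans (le_max_left _ _)
  -- continuity, hence interval integrability, of the integrands
  have hcont : ∀ z : L2C,
      ContinuousOn (fun s => eulerForm (U s) (U s) (heat (ν * (t - s)) z)) (Icc 0 t) := fun z =>
    continuousOn_eulerForm_of_continuousOn hc hfin hM
      ((continuous_heat_apply z).comp (continuous_const.mul (continuous_const.sub continuous_id))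
        |>.continuousOn)
  have hint : ∀ z : L2C,
      IntervalIntegrable (fun s => eulerForm (U s) (U s) (heat (ν * (t - s)) z)) volume 0 t := by
    intro z
    refine ContinuousOn.intervalIntegrable ?_
    rw [uIcc_of_le ht]
    exact hcont z
  -- the Lipschitz bound in the test slot
  have hbound : ∀ n, ‖(∫ s in (0:ℝ)..t, eulerForm (U s) (U s) (heat (ν * (t - s)) (Φ n))) -
      ∫ s in (0:ℝ)..t, eulerForm (U s) (U s) (heat (ν * (t - s)) w)‖ ≤
      K * M' * M' * ‖Φ n - w‖ * |t - 0| := by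
    intro n
    rw [← intervalIntegral.integral_sub (hint (Φ n)) (hint w)]
    refine intervalIntegral.norm_integral_le_of_norm_le_const fun s hs => ?_
    rw [uIoc_of_le ht] at hs
    have hs' : s ∈ Icc 0 t := ⟨hs.1.le, hs.2⟩
    -- `e^{τΔ}` is linear (`heat τ = fourierMultiplier _`)
    have hlin : heat (ν * (t - s)) (Φ n) - heat (ν * (t - s)) w = heat (ν * (t - s)) (Φ n - w) :=
      (fourierMultiplier_sub _ (Φ n) w).symm
    rw [eulerForm_sub₃ _ _ (hfin s hs') (hfin s hs'), hlin]
    refine (norm_eulerForm_le _ (hfin s hs') (hfin s hs')).trans ?_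
    have h1 := hreal s hs'
    have h2 := norm_heat_le (ν * (t - s)) (Φ n - w)
    gcongr
  rw [tendsto_iff_norm_sub_tendsto_zero]
  refine squeeze_zero (fun n => norm_nonneg _) hbound ?_
  have h := ((tendsto_iff_norm_sub_tendsto_zero.1 hΦ).const_mul (K * M' * M')).mul_const |t - 0|
  simpa using h

/-! ### Passage to the limit in the identity -/

/-- **The identity passes to `L²` limits of the test field**: if Tao's identity at time `t`
holds for every `Φ n` and `Φ n → w` in `L²`, it holds for `w`. [cite: Tao2016AveragedNS, §1.1 (1.15)] -/
theorem pairing_identity_of_tendsto {ν t : ℝ} (ht : 0 ≤ t) {U : ℝ → L2C}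
    (hfin : ∀ s ∈ Icc 0 t, eFourierSobolevNorm 10 (U s) < ⊤) (hc : ContinuousInH10On (Icc 0 t) U)
    {Φ : ℕ → L2C} {w : L2C} (hΦ : Tendsto Φ atTop (𝓝 w))
    (hid : ∀ n, pairing (U t) (Φ n) = pairing (heat (ν * t) (U 0)) (Φ n) +
      ∫ s in (0:ℝ)..t, eulerForm (U s) (U s) (heat (ν * (t - s)) (Φ n))) :
    pairing (U t) w = pairing (heat (ν * t) (U 0)) w +
      ∫ s in (0:ℝ)..t, eulerForm (U s) (U s) (heat (ν * (t - s)) w) := by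
  have h1 : Tendsto (fun n => pairing (U t) (Φ n)) atTop (𝓝 (pairing (U t) w)) :=
    ((continuous_pairing_right (U t)).tendsto w).comp hΦ
  have h2 : Tendsto (fun n => pairing (heat (ν * t) (U 0)) (Φ n)) atTop
      (𝓝 (pairing (heat (ν * t) (U 0)) w)) :=
    ((continuous_pairing_right _).tendsto w).comp hΦ
  have h3 := tendsto_intervalIntegral_eulerForm_heat (ν := ν) ht hfin hc hΦ
  exact tendsto_nhds_unique (h1.congr hid) (h2.add h3)

/-! ### The stub -/

/-- **S3 — from test fields to all of `H¹⁰_df`**: Tao's identity (1.15) at viscosity `ν`,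
known for every complexified `φ ∈ C_{c,σ}^∞`, holds for every `w ∈ H¹⁰_df` (both sides are
`L²`-continuous in `w` by `norm_eulerForm_le` and the `L²`-contractivity of `e^{τΔ}`;
`C_{c,σ}^∞` is `L²`-dense in the real Fourier-divergence-free classes,
`exists_divFreeTest_tendsto`). [cite: Tao2016AveragedNS, §1.1 (1.15)] -/
theorem stub_testToH10 {ν T : ℝ} (U : ℝ → L2C)
    (hH : ∀ t ∈ Ico 0 T, MemH10df (U t)) (hc : ContinuousInH10On (Ico 0 T) U)
    (htest : ∀ t ∈ Ico 0 T, ∀ φ ∈ divFreeTest ℝ³, ∀ (h2φ : MemLp (complexify ∘ φ) 2 (volume : Measure ℝ³)),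
      pairing (U t) (h2φ.toLp _) = pairing (heat (ν * t) (U 0)) (h2φ.toLp _) +
        ∫ s in (0:ℝ)..t, eulerForm (U s) (U s) (heat (ν * (t - s)) (h2φ.toLp _))) :
    ∀ t ∈ Ico 0 T, ∀ w, MemH10df w →
      pairing (U t) w = pairing (heat (ν * t) (U 0)) w +
        ∫ s in (0:ℝ)..t, eulerForm (U s) (U s) (heat (ν * (t - s)) w) := by
  intro t ht w hw
  obtain ⟨φ, hφ, h2, hΦ⟩ := exists_divFreeTest_tendsto hw.2.1 hw.2.2
  have hI : Icc 0 t ⊆ Ico 0 T := fun s hs => ⟨hs.1, lt_of_le_of_lt hs.2 ht.2⟩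
  exact pairing_identity_of_tendsto ht.1 (fun s hs => (hH s (hI hs)).1) (hc.mono hI) hΦ
    fun n => htest t ht (φ n) (hφ n) (h2 n)

end Summit.NavierStokesRegularity.NavierStokesRegularity.Theorems.PerpetualPumpEulerTypeIGlue

end
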